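import Summits.NavierStokesRegularity.FluidComputer.RowSwitchWindow
import HarnessLib

/-!
# `RowSwitchRoot`: the ROOT of the new lock coordinate in the switch window — existence from (D) by the
# intermediate value theorem, uniqueness from (U) by strict monotonicity (`pub-fluidc-bp3/R1-DESIGN.md`
# §10.6 (iii), (iv); layer B′, consumed by PhaseLock (A′) only)

HONEST FRAMING (cell `pub-fluidc`, blueprint seat bp3, gen 22): low prior, high value-of-information
experiment on Tao's machine paradigm; NOT a claim that NS blows up. Bookkeeping only: with the window facts
of `RowSwitchWindow` (`|I| ≤ B`, `|d| < wid` on `[σ − Ds, σ + Ds]`) the new lock coordinate's deviation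
`d_{p'}(ξ) = y_{p'}(ξ) − X0_{p'} = e_{p'} + (ξ − σ) F0_{p'} + I_{p'}(ξ)` has the sign of `±F0_{p'}` at the
two window ends by (D) `Ds·|F0_{p'}|_lo ≥ Ē_{p'} + B_{p'} + 2^{-P}` — so it vanishes somewhere in the window
(`window_root`) — and `ẏ_{p'} = F0_{p'} + (J0 d)_{p'} + F(d)_{p'} + δF_{p'}` has the sign of `F0_{p'}` on
the whole window by (U) — so `y_{p'}` is strictly monotone there and the root is unique
(`window_strictMono`, `window_root_unique`).  The stage hand-over's soundness (`RowSwitchStage`) does not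
need this file (the new member's own lock supplies the root); PhaseLock (A′) does: it is where the new
stage's phase map starts.

[cite: Tao2016AveragedNS, §5.5 Thm 5.3 (5.5)]
-/

namespace Summit.NavierStokesRegularity.FluidComputer

open Literature.Analysis.FluidPDE.FluidComputer

namespace RowCheck

open DIVec ChainField Finset Real Set Matrix
open Literature.Analysis.ValidatedNumerics.Numerics (cdiv)

namespace RowData

variable {r r' : RowData} {c : SwCert}

/-- The sign of the new lock coordinate's reference velocity `F0_{p'}`, read off the certificate:
`+1` if the enclosure `F0I p'` is positive, else `−1`. [folklore] -/
noncomputable def sgnF (r' : RowData) : ℝ := if (r'.F0I r'.p).posB = true then 1 else -1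

/-- [folklore] -/
theorem sgnF_mul_self (r' : RowData) : sgnF r' * sgnF r' = 1 := by
  unfold sgnF; split_ifs <;> norm_num

/-- [folklore] -/
theorem abs_sgnF_mul (r' : RowData) (x : ℝ) : |sgnF r' * x| = |x| := by
  rw [abs_mul]; unfold sgnF; split_ifs <;> simp

/-- `PhiLo ≤ sgn · F0_{p'}` (scaled by `2^P`): the certificate's phase-speed floor. [folklore] -/
theorem phiLo_le (G' : r'.GateOK) :
    (r'.PhiLo : ℝ) / 2 ^ r'.P ≤ sgnF r' * F G'.g G'.Λ r'.X0R r'.p := by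
  have hO : (0 : ℝ) < 2 ^ r'.P := by positivity
  obtain ⟨h1, h2⟩ := mem_F0I G' r'.p
  rw [div_le_iff₀ hO]
  unfold sgnF PhiLo
  by_cases hp : (r'.F0I r'.p).posB = true
  · rw [if_pos hp, if_pos hp]; linarith
  · rw [if_neg hp, if_neg hp]; push_cast; linarith

/-- The deviation of `ẏ_a` from `F0_a` on the window box `|y − X0| < wid`:
`|F(y)_a + δ_a − F0_a| ≤ (Σ_b ⌈|J0I ab| wid_b⌉ + FabsB(wid)_a + DELw_a)/2^P`. [folklore] -/
theorem abs_dev_le_wid (G' : r'.GateOK) {x δ : Fin 9 → ℝ}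
    (hδ : ∀ a, |δ a| ≤ ((max (r.DEL a) (r'.DEL a) : ℤ) : ℝ) / 2 ^ r'.P)
    (hw : ∀ b, |x b - r'.X0R b| < (c.wid b : ℝ) / 2 ^ r'.P) (a : Fin 9) :
    |F G'.g G'.Λ x a + δ a - F G'.g G'.Λ r'.X0R a| ≤
      (((∑ bb, cdiv ((r'.J0I a bb).mag * c.wid bb) (2 ^ r'.P)) + FabsB r'.P r'.cU r'.cD c.wid a +
        max (r.DEL a) (r'.DEL a) : ℤ) : ℝ) / 2 ^ r'.P := by
  set X0 := r'.X0R with hX0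
  set d : Fin 9 → ℝ := fun b => x b - X0 b with hd
  have hx : x = X0 + d := by ext b; simp [hd]
  have htay : F G'.g G'.Λ x a + δ a - F G'.g G'.Λ X0 a =
      (Jmat G'.g G'.Λ X0).mulVec d a + F G'.g G'.Λ d a + δ a := by
    rw [hx, taylor_split_mat]; simp only [Pi.add_apply]; ring
  have hdw : ∀ b, |d b| ≤ (c.wid b : ℝ) / 2 ^ r'.P := fun b => (hw b).le
  have hJ : |(Jmat G'.g G'.Λ X0).mulVec d a| ≤
      ((∑ bb, cdiv ((r'.J0I a bb).mag * c.wid bb) (2 ^ r'.P) : ℤ) : ℝ) / 2 ^ r'.P := by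
    simp only [Matrix.mulVec, dotProduct]
    exact abs_sum_le_cdiv r'.P (MI := fun bb => r'.J0I a bb)
      (fun bb => mem_JmatI G'.hU G'.hD (fun k => mem_X0I r' k) a bb) hdw
  have h2 := abs_F_le_FabsB G'.hU G'.hD (E := d) (EB := c.wid) hdw a
  have h5 := abs_add_three ((Jmat G'.g G'.Λ X0).mulVec d a) (F G'.g G'.Λ d a) (δ a)
  have h4 := hδ a
  rw [htay]
  push_cast at hJ h2 h4 ⊢
  rw [add_div, add_div]
  linarith

/-- **Root existence** ((D) + IVT): under the hypotheses of the window lemma, `y_{p'}` takes the value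
`X0_{p'}` somewhere in the window `[σ − Ds, σ + Ds]`. [folklore] -/
theorem window_root (W : SwWin r r' c) (G' : r'.GateOK) {y δF : ℝ → Fin 9 → ℝ} {D : Set ℝ} {σ : ℝ}
    (hD : Icc (σ - (c.Ds : ℝ) / 2 ^ r'.P) (σ + (c.Ds : ℝ) / 2 ^ r'.P) ⊆ D)
    (hy : ∀ ξ ∈ D, ∀ a, HasDerivAt (fun τ => y τ a) (F G'.g G'.Λ (y ξ) a + δF ξ a) ξ)
    (hδ : ∀ ξ ∈ Icc (σ - (c.Ds : ℝ) / 2 ^ r'.P) (σ + (c.Ds : ℝ) / 2 ^ r'.P), ∀ a,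
      |δF ξ a| ≤ ((max (r.DEL a) (r'.DEL a) : ℤ) : ℝ) / 2 ^ r'.P)
    (he : ∀ a, |y σ a - r'.X0R a| ≤ (r.Eb a : ℝ) / 2 ^ r'.P) :
    ∃ ξ ∈ Icc (σ - (c.Ds : ℝ) / 2 ^ r'.P) (σ + (c.Ds : ℝ) / 2 ^ r'.P), y ξ r'.p = r'.X0R r'.p := by
  have hO : (0 : ℝ) < 2 ^ r'.P := by positivity
  have hI := window_I W G' hD hy hδ he
  have hΦ := phiLo_le (r' := r') G'
  set DsR : ℝ := (c.Ds : ℝ) / 2 ^ r'.P with hDsR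
  have hDs0 : 0 ≤ DsR := by have := W.hDs; positivity
  set g : ℝ → ℝ := fun ξ => sgnF r' * (y ξ r'.p - r'.X0R r'.p) with hg
  have hcont : ContinuousOn g (Icc (σ - DsR) (σ + DsR)) := by
    refine ContinuousOn.mul continuousOn_const (ContinuousOn.sub ?_ continuousOn_const)
    intro ξ hξ
    exact (hy ξ (hD hξ) r'.p).continuousAt.continuousWithinAt
  -- (D): `(Ē_p + B_p + 1)/2^P ≤ DsR · PhiLo/2^P`
  have hD' : ((r.Eb r'.p : ℝ) + ((c.b (Fin.last 16) r'.p : ℤ) : ℝ) + 1) * 2 ^ r'.P ≤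
      (c.Ds : ℝ) * (r'.PhiLo : ℝ) := by
    have h := W.hD
    have h2 : (((r.Eb r'.p + c.b (Fin.last 16) r'.p + 1) * 2 ^ r'.P : ℤ) : ℝ) ≤
        ((c.Ds * r'.PhiLo : ℤ) : ℝ) := Int.cast_le.mpr h
    simpa only [Int.cast_mul, Int.cast_add, Int.cast_one, Int.cast_pow, Int.cast_natCast,
      Int.cast_ofNat] using h2
  have hDD : ((r.Eb r'.p : ℝ) + ((c.b (Fin.last 16) r'.p : ℤ) : ℝ)) / 2 ^ r'.P + 1 / 2 ^ r'.P ≤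
      DsR * ((r'.PhiLo : ℝ) / 2 ^ r'.P) := by
    rw [hDsR, div_mul_div_comm, ← add_div, div_le_div_iff₀ hO (by positivity)]
    nlinarith
  have hm : DsR * ((r'.PhiLo : ℝ) / 2 ^ r'.P) ≤ DsR * (sgnF r' * F G'.g G'.Λ r'.X0R r'.p) :=
    mul_le_mul_of_nonneg_left hΦ hDs0
  have h1P : (0 : ℝ) < 1 / 2 ^ r'.P := by positivity
  -- the decomposition `y ξ p − X0 p = (y σ p − X0 p) + (ξ − σ) F0 p + I`
  have hval : ∀ ξ ∈ Icc (σ - DsR) (σ + DsR),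
      |g ξ - (ξ - σ) * (sgnF r' * F G'.g G'.Λ r'.X0R r'.p)| ≤
        ((r.Eb r'.p : ℝ) + ((c.b (Fin.last 16) r'.p : ℤ) : ℝ)) / 2 ^ r'.P := by
    intro ξ hξ
    have h1 := hI ξ hξ r'.p
    have h2 := he r'.p
    have h3 : g ξ - (ξ - σ) * (sgnF r' * F G'.g G'.Λ r'.X0R r'.p) =
        sgnF r' * (y σ r'.p - r'.X0R r'.p) +
          sgnF r' * (y ξ r'.p - y σ r'.p - (ξ - σ) * F G'.g G'.Λ r'.X0R r'.p) := by
      simp only [hg]; ring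
    rw [h3, add_div]
    refine (abs_add_le _ _).trans ?_
    rw [abs_sgnF_mul, abs_sgnF_mul]
    exact add_le_add h2 h1
  -- signs at the two ends
  have hplus : 0 < g (σ + DsR) := by
    have h := hval (σ + DsR) ⟨by linarith, le_rfl⟩
    rw [show σ + DsR - σ = DsR by ring] at h
    have h' := (abs_le.1 h).1
    linarith
  have hminus : g (σ - DsR) < 0 := by
    have h := hval (σ - DsR) ⟨le_rfl, by linarith⟩
    rw [show σ - DsR - σ = -DsR by ring] at h
    have h' := (abs_le.1 h).2
    linarith
  -- IVT
  have hivt := intermediate_value_Icc (show σ - DsR ≤ σ + DsR by linarith) hcont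
  obtain ⟨ξ, hξ, hgξ⟩ := hivt ⟨hminus.le, hplus.le⟩
  refine ⟨ξ, hξ, ?_⟩
  have h0 : sgnF r' * (y ξ r'.p - r'.X0R r'.p) = 0 := hgξ
  rcases mul_eq_zero.1 h0 with h | h
  · have := sgnF_mul_self r'; rw [h, zero_mul] at this; exact absurd this zero_ne_one
  · linarith

/-- **Monotonicity** ((U)): under the hypotheses of the window lemma, `sgn · y_{p'}` is strictly
increasing on the window. [folklore] -/
theorem window_strictMono (W : SwWin r r' c) (G' : r'.GateOK) {y δF : ℝ → Fin 9 → ℝ} {D : Set ℝ}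
    {σ : ℝ} (hD : Icc (σ - (c.Ds : ℝ) / 2 ^ r'.P) (σ + (c.Ds : ℝ) / 2 ^ r'.P) ⊆ D)
    (hy : ∀ ξ ∈ D, ∀ a, HasDerivAt (fun τ => y τ a) (F G'.g G'.Λ (y ξ) a + δF ξ a) ξ)
    (hδ : ∀ ξ ∈ Icc (σ - (c.Ds : ℝ) / 2 ^ r'.P) (σ + (c.Ds : ℝ) / 2 ^ r'.P), ∀ a,
      |δF ξ a| ≤ ((max (r.DEL a) (r'.DEL a) : ℤ) : ℝ) / 2 ^ r'.P)
    (he : ∀ a, |y σ a - r'.X0R a| ≤ (r.Eb a : ℝ) / 2 ^ r'.P) :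
    StrictMonoOn (fun ξ => sgnF r' * y ξ r'.p)
      (Icc (σ - (c.Ds : ℝ) / 2 ^ r'.P) (σ + (c.Ds : ℝ) / 2 ^ r'.P)) := by
  have hO : (0 : ℝ) < 2 ^ r'.P := by positivity
  have hwd := window_d W G' hD hy hδ he
  have hΦ := phiLo_le (r' := r') G'
  have hcont : ContinuousOn (fun ξ => sgnF r' * y ξ r'.p)
      (Icc (σ - (c.Ds : ℝ) / 2 ^ r'.P) (σ + (c.Ds : ℝ) / 2 ^ r'.P)) := by
    refine ContinuousOn.mul continuousOn_const ?_
    intro ξ hξ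
    exact (hy ξ (hD hξ) r'.p).continuousAt.continuousWithinAt
  have hU0 : (((∑ bb, cdiv ((r'.J0I r'.p bb).mag * c.wid bb) (2 ^ r'.P)) +
      FabsB r'.P r'.cU r'.cD c.wid r'.p + max (r.DEL r'.p) (r'.DEL r'.p) : ℤ) : ℝ) <
      ((r'.PhiLo : ℤ) : ℝ) := Int.cast_lt.mpr W.hU
  have hU := div_lt_div_of_pos_right hU0 hO
  refine strictMonoOn_of_deriv_pos (convex_Icc _ _) hcont fun ξ hξ => ?_
  rw [interior_Icc] at hξ
  have hξ' : ξ ∈ Icc (σ - (c.Ds : ℝ) / 2 ^ r'.P) (σ + (c.Ds : ℝ) / 2 ^ r'.P) :=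
    Ioo_subset_Icc_self hξ
  have hd : HasDerivAt (fun τ => sgnF r' * y τ r'.p)
      (sgnF r' * (F G'.g G'.Λ (y ξ) r'.p + δF ξ r'.p)) ξ := (hy ξ (hD hξ') r'.p).const_mul _
  rw [hd.deriv]
  have hdev := abs_dev_le_wid (r := r) (c := c) G' (hδ ξ hξ') (hwd ξ hξ') r'.p
  have hsplit : sgnF r' * (F G'.g G'.Λ (y ξ) r'.p + δF ξ r'.p) =
      sgnF r' * F G'.g G'.Λ r'.X0R r'.p +
        sgnF r' * (F G'.g G'.Λ (y ξ) r'.p + δF ξ r'.p - F G'.g G'.Λ r'.X0R r'.p) := by ring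
  rw [hsplit]
  have h1 : |sgnF r' * (F G'.g G'.Λ (y ξ) r'.p + δF ξ r'.p - F G'.g G'.Λ r'.X0R r'.p)| <
      (r'.PhiLo : ℝ) / 2 ^ r'.P := by
    rw [abs_sgnF_mul]; exact hdev.trans_lt hU
  have h2 := (abs_lt.1 h1).1
  linarith

/-- **Root uniqueness**: under the hypotheses of the window lemma, `y_{p'}` takes each value at most once
in the window; in particular the root of `window_root` is unique. [folklore] -/
theorem window_root_unique (W : SwWin r r' c) (G' : r'.GateOK) {y δF : ℝ → Fin 9 → ℝ} {D : Set ℝ}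
    {σ : ℝ} (hD : Icc (σ - (c.Ds : ℝ) / 2 ^ r'.P) (σ + (c.Ds : ℝ) / 2 ^ r'.P) ⊆ D)
    (hy : ∀ ξ ∈ D, ∀ a, HasDerivAt (fun τ => y τ a) (F G'.g G'.Λ (y ξ) a + δF ξ a) ξ)
    (hδ : ∀ ξ ∈ Icc (σ - (c.Ds : ℝ) / 2 ^ r'.P) (σ + (c.Ds : ℝ) / 2 ^ r'.P), ∀ a,
      |δF ξ a| ≤ ((max (r.DEL a) (r'.DEL a) : ℤ) : ℝ) / 2 ^ r'.P)
    (he : ∀ a, |y σ a - r'.X0R a| ≤ (r.Eb a : ℝ) / 2 ^ r'.P) :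
    InjOn (fun ξ => y ξ r'.p) (Icc (σ - (c.Ds : ℝ) / 2 ^ r'.P) (σ + (c.Ds : ℝ) / 2 ^ r'.P)) := by
  intro ξ₁ h₁ ξ₂ h₂ h
  have hm := window_strictMono W G' hD hy hδ he
  exact hm.injOn h₁ h₂ (by simp only at h ⊢; rw [h])

end RowData

end RowCheck

end Summit.NavierStokesRegularity.FluidComputer
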